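import Literature.MathematicalPhysics.QuantumLattice.SectorisedKernelNormRefinementPlateauPrescribedWt
import Literature.Probability.LatticeModels.SubmultiplicativeTreeWeight
import HarnessLib

/-!
# Weighted re-sectorisation with prescribed legs, TREE-WEIGHT form: the fine tuple's tree weight is dominated by the coarse tuple's weight times
# the pair weights of the leg displacements

Topic `MathematicalPhysics/QuantumLattice`; puts `SectorisedKernelNormRefinementPlateauPrescribedWt` (abstract weights `wf ≤ wc·∏ω`) in the currency of
the tree's weighted norms (`Literature.Probability.LatticeModels.BattleFederbush.IsTreeWeight`: weight of a label tuple `= wt (image of its positions)`,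
weighted overlap constants `Σ ‖(E(F′)S(F̃))(X″,X′)‖·wt{g X″.1, g X′.1}` — the convention of `SectorisedEffectiveActionBoundWeightedPlateau` and of the
engine's `klWtPinnedSum`).  Benfatto–Giuliani–Mastropietro 2006 §3 (3.2)–(3.8): along the spanning tree the decay weight of a cluster is submultiplicative,
so the weight of the re-sectorised (fine) positions is at most the weight of the coarse positions times one pair weight per leg:

* `IsTreeWeight.wt_image_le_wt_image_mul_prod_pair` — for a tree weight `wt`, a position map `g` and tuples `x″, x′`:
  `wt (g″(x″)) ≤ wt (g(x′)) · ∏_i wt {g(x″_i), g(x′_i)}` (images of the tuples; generic);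
* **`hubbardSectorPrescribedSumWt_refine_le_split_of_plateau_pair_treeWt`** — the weighted prescribed-legs re-sectorisation across a plateau pair with
  the weights `wt ((univ.image x).image g)` on both sides and the pair-weighted per-leg overlap sums `Σ_{x″} ‖T((x″,ℓ″),X′)‖·wt{g x″, g X′.1} ≤ c₁`,
  `Σ_{x′} ‖T(X″,(x′,ℓ′))‖·wt{g X″.1, g x′} ≤ c₁r`:
  `ε_x^m Σ_{σ″|_E = τ″|_E} Σ_{x″_p = x} wt(g(x″))‖W_{F′,σ″}(x″)‖ ≤ c₁^m · c₁r · ρ^{|E|} · ε_x^m · (ε_x · (R₁N₁ + R₂N₂))`.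

Cell gate-hubbard-kl, K3 engine child clause (E1): WEIGHTED levels track of the blocked birth-level tower (tree weight `klScaleWt = diamWeight …`,
`isTreeWeight_diamWeight`).  Everything is proved; no definition, no named fact.

## Sources

G. Benfatto, A. Giuliani, V. Mastropietro, Ann. Henri Poincaré 7 (2006) 809–898, §2.8 (2.77), (2.82)–(2.84), (2.88)–(2.90), §3 (3.2)–(3.8)
[`BenfattoGiulianiMastropietro2006`].
-/

noncomputable section

open Finset

namespace Literature.Probability.LatticeModels.BattleFederbush.IsTreeWeight

variable {Λ : Type*} [DecidableEq Λ] {wt : Finset Λ → ℝ} {P : Type*} [DecidableEq P]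

/-- **The tree weight of a displaced tuple**: for a tree weight `wt`, a position map `g` and two tuples `x″, x′` of the same length,
`wt (image (g ∘ x″)) ≤ wt (image (g ∘ x′)) · ∏_i wt {g (x″ i), g (x′ i)}` — join each fine position to its coarse partner; the union of the coarse set
with the pairs is connected through the coarse positions (submultiplicativity on overlapping unions), and contains the fine set (monotonicity).
[cite: BenfattoGiulianiMastropietro2006, §3 (3.2)-(3.8)] -/
theorem wt_image_le_wt_image_mul_prod_pair (h : IsTreeWeight wt) (g : P → Λ) {n : ℕ} (x'' x' : Fin n → P) :
    wt ((univ.image x'').image g) ≤ wt ((univ.image x').image g) * ∏ i, wt {g (x'' i), g (x' i)} := by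
  classical
  -- the growing union of the coarse set with the pairs
  set U : Finset (Fin n) → Finset Λ := fun s => (univ.image x').image g ∪ s.biUnion fun i => {g (x'' i), g (x' i)} with hU
  have hstep : ∀ s : Finset (Fin n), wt (U s) ≤ wt ((univ.image x').image g) * ∏ i ∈ s, wt {g (x'' i), g (x' i)} := by
    intro s
    induction s using Finset.induction_on with
    | empty => simp [hU]
    | insert i s hi ih =>
      have hUi : U (insert i s) = U s ∪ {g (x'' i), g (x' i)} := by
        simp only [hU, biUnion_insert]
        rw [union_comm ({g (x'' i), g (x' i)} : Finset Λ) (s.biUnion fun i => {g (x'' i), g (x' i)}), ← union_assoc]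
      have hov : (U s ∩ {g (x'' i), g (x' i)}).Nonempty := by
        refine ⟨g (x' i), mem_inter.2 ⟨?_, by simp⟩⟩
        simp only [hU, mem_union]
        exact Or.inl (mem_image_of_mem g (mem_image_of_mem x' (mem_univ i)))
      rw [hUi, prod_insert hi]
      calc wt (U s ∪ {g (x'' i), g (x' i)}) ≤ wt (U s) * wt {g (x'' i), g (x' i)} := h.union_le hov
        _ ≤ (wt ((univ.image x').image g) * ∏ j ∈ s, wt {g (x'' j), g (x' j)}) * wt {g (x'' i), g (x' i)} :=
            mul_le_mul_of_nonneg_right ih (h.nonneg _)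
        _ = wt ((univ.image x').image g) * (wt {g (x'' i), g (x' i)} * ∏ j ∈ s, wt {g (x'' j), g (x' j)}) := by ring
  have hsub : (univ.image x'').image g ⊆ U univ := by
    intro a ha
    obtain ⟨y, hy, rfl⟩ := mem_image.1 ha
    obtain ⟨i, _, rfl⟩ := mem_image.1 hy
    simp only [hU, mem_union, mem_biUnion, mem_univ, true_and, mem_insert, mem_singleton]
    exact Or.inr ⟨i, Or.inl rfl⟩
  exact (h.mono hsub).trans (hstep univ)

end Literature.Probability.LatticeModels.BattleFederbush.IsTreeWeight

namespace Literature.MathematicalPhysics.QuantumLattice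

open GrassmannAlgebra Literature.Probability.LatticeModels Literature.Probability.LatticeModels.BattleFederbush

variable {L M : ℕ} [NeZero L] [NeZero M] {N N' : ℕ} {Λ : Type*} [DecidableEq Λ] {wt : Finset Λ → ℝ}

/-- **Tree-weighted prescribed-legs sizes across a plateau pair, split count** (BGM 2006 §2.8 (2.77), (2.82)–(2.90), §3 (3.2)–(3.8)): as
`hubbardSectorPrescribedSumWt_refine_le_split_of_plateau_pair` with the weights of the tree's weighted norms — a tree weight `wt` of the set of (mapped)
leg positions `wt ((univ.image x).image g)` on the fine and on the coarse side — and the PAIR-weighted per-leg sums of the overlap kernel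
`Σ_{x″} ‖(E(F′)S(F̃))((x″,ℓ″),X′)‖·wt{g x″, g X′.1} ≤ c₁`, `Σ_{x′} ‖(E(F′)S(F̃))(X″,(x′,ℓ′))‖·wt{g X″.1, g x′} ≤ c₁r`:
`ε_x^m Σ_{σ″ ∈ A″, σ″|_E = τ″|_E} Σ_{x″_p = x} wt(g(x″))‖W_{F′,σ″}(x″)‖ ≤ c₁^m · c₁r · ρ^{|E|} · ε_x^m · (ε_x · (R₁N₁ + R₂N₂))`, `N₁`/`N₂` bounding the
`wt`-weighted coarse prescribed sums. [cite: BenfattoGiulianiMastropietro2006, §2.8 (2.77), (2.82)-(2.84) and (2.88)-(2.90), §3 (3.2)-(3.8)] -/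
theorem hubbardSectorPrescribedSumWt_refine_le_split_of_plateau_pair_treeWt (hwt : IsTreeWeight wt) (g : SpaceTimeIdx L M → Λ)
    {β : ℝ} (hβ : 0 < β) (F Ft : Fin N → FreqMomentum L M → ℂ)
    (hFF : ∀ ω k, Ft ω k * F ω k = F ω k) (hF0 : ∀ k, ∑ ω, F ω k = 0 → ∀ ω, F ω k = 0) (F' : Fin N' → FreqMomentum L M → ℂ)
    (hF'pl : ∀ (ω' : Fin N') (k : FreqMomentum L M), F' ω' k ≠ 0 → ∑ ω, F ω k = 1) (G : HubbardGrassmann L M)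
    (child : Fin N' → Fin N → Prop) [DecidableRel child]
    (hchild : ∀ ω'' ω', ¬ child ω'' ω' → ∀ k, F' ω'' k * Ft ω' k = 0)
    {c₁ c₁r ρc R₁ R₂ N₁ N₂ : ℝ} (hc₁0 : 0 ≤ c₁) (hc₁r0 : 0 ≤ c₁r) (hR₁ : 0 ≤ R₁) (hR₂ : 0 ≤ R₂) (hN₁0 : 0 ≤ N₁) (hN₂0 : 0 ≤ N₂)
    (hcol₁ : ∀ (ℓ'' : SectorLeg N') (X' : SpaceTimeIdx L M × SectorLeg N),
      ∑ x'' : SpaceTimeIdx L M, ‖(sectorAnalysisMatrix L M β F' * sectorSubMatrix L M β Ft) (x'', ℓ'') X'‖ * wt {g x'', g X'.1} ≤ c₁)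
    (hrow₁ : ∀ (X'' : SpaceTimeIdx L M × SectorLeg N') (ℓ' : SectorLeg N),
      ∑ x' : SpaceTimeIdx L M, ‖(sectorAnalysisMatrix L M β F' * sectorSubMatrix L M β Ft) X'' (x', ℓ')‖ * wt {g X''.1, g x'} ≤ c₁r)
    (hρ : ∀ ℓ'' : SectorLeg N',
      (((univ.filter fun ℓ' : SectorLeg N => child ℓ''.1.1 ℓ'.1.1 ∧ ℓ'.1.2 = ℓ''.1.2 ∧ ℓ'.2 = ℓ''.2).card : ℝ)) ≤ ρc)
    (m : ℕ) (A'' : Finset (Fin (m + 1) → SectorLeg N')) (B : Finset (Fin (m + 1) → SectorLeg N))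
    (E : Finset (Fin (m + 1))) (τ'' : Fin (m + 1) → SectorLeg N') (p : Fin (m + 1)) (hp : p ∈ E)
    (hRoff : ∀ σ' : Fin (m + 1) → SectorLeg N, σ' ∉ B →
      (((A''.filter fun σ'' => (∀ e ∈ E, σ'' e = τ'' e) ∧
          ∀ i, child (σ'' i).1.1 (σ' i).1.1 ∧ (σ' i).1.2 = (σ'' i).1.2 ∧ (σ' i).2 = (σ'' i).2).card : ℝ)) ≤ R₁)
    (hRon : ∀ σ' : Fin (m + 1) → SectorLeg N, σ' ∈ B →
      (((A''.filter fun σ'' => (∀ e ∈ E, σ'' e = τ'' e) ∧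
          ∀ i, child (σ'' i).1.1 (σ' i).1.1 ∧ (σ' i).1.2 = (σ'' i).1.2 ∧ (σ' i).2 = (σ'' i).2).card : ℝ)) ≤ R₂)
    (hN₁ : ∀ (τ' : Fin (m + 1) → SectorLeg N) (y : SpaceTimeIdx L M),
      imagTimeWeight β M ^ m * ∑ σ' ∈ univ.filter (fun σ' : Fin (m + 1) → SectorLeg N => ∀ e ∈ E, σ' e = τ' e),
        ∑ x' ∈ univ.filter (fun x' : Fin (m + 1) → SpaceTimeIdx L M => x' p = y),
          wt ((univ.image x').image g) * ‖sectorisedKernel L M β F G (m + 1) σ' x'‖ ≤ N₁)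
    (hN₂ : ∀ (τ' : Fin (m + 1) → SectorLeg N) (y : SpaceTimeIdx L M),
      imagTimeWeight β M ^ m * ∑ σ' ∈ B.filter (fun σ' : Fin (m + 1) → SectorLeg N => ∀ e ∈ E, σ' e = τ' e),
        ∑ x' ∈ univ.filter (fun x' : Fin (m + 1) → SpaceTimeIdx L M => x' p = y),
          wt ((univ.image x').image g) * ‖sectorisedKernel L M β F G (m + 1) σ' x'‖ ≤ N₂)
    (x : SpaceTimeIdx L M) :
    imagTimeWeight β M ^ m * ∑ σ'' ∈ A''.filter (fun σ'' => ∀ e ∈ E, σ'' e = τ'' e),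
        ∑ x'' ∈ univ.filter (fun x'' : Fin (m + 1) → SpaceTimeIdx L M => x'' p = x),
          wt ((univ.image x'').image g) * ‖sectorisedKernel L M β F' G (m + 1) σ'' x''‖ ≤
      c₁ ^ m * c₁r * ρc ^ E.card * imagTimeWeight β M ^ m * (imagTimeWeight β M * (R₁ * N₁ + R₂ * N₂)) := by
  classical
  exact hubbardSectorPrescribedSumWt_refine_le_split_of_plateau_pair hβ F Ft hFF hF0 F' hF'pl G child hchild hc₁0 hc₁r0 hR₁ hR₂
    hN₁0 hN₂0 (fun x'' x' => wt {g x'', g x'}) (fun x'' x' => hwt.nonneg _) hcol₁ hrow₁ hρ m A'' B E τ'' p hp hRoff hRon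
    (fun x'' => wt ((univ.image x'').image g)) (fun x' => wt ((univ.image x').image g)) (fun x'' => hwt.nonneg _)
    (fun x' => hwt.nonneg _) (fun x'' x' => hwt.wt_image_le_wt_image_mul_prod_pair g x'' x') hN₁ hN₂ x

end Literature.MathematicalPhysics.QuantumLattice

end
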